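import Summits.CriticalPhenomena.PercolationContinuityZ3.Theorems.PercNearOneGluingNoHeavyQuantBlockCombClass
import HarnessLib

/-!
# QUANT lane R8, FAR on trees: the PAIR WITNESS for block-combs (two blobs of total size `≥ j+1` force `TAIL ≥ W_l·g s₀·g s₁`)

builds on p205010 (kernel theorem, internal audit signed; external expert review pending)

Support file (`--supports stmt-CriticalPhenomena-4575`), QUANT lane seat prim-quant-census-2 (gen 48); memo
`run/shared/lean/prim/quant/prim-quant-census-2-g48/TIED-PLUS-TWO-G48.md` §2 (B2).  Theorems only (local notation, no definitions), no sorries, standard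
axioms.  Model/notation: `…QuantBlockCombMergeModel.lean`; tools: `tail_mono_gates` (lead g12), `pd_tail_sum` (p1 g8).  Used by `…QuantBlockCombTiedPlusTwo.lean`.

* `Quant.BlockComb.tail_ge_pair_witness` — two distinct blobs `s₀, s₁` with `a s₀ + a s₁ ≥ j+1`, both at levels `≤ l ≤ D`:
  `(∏_{i<l} q i)·g s₀·g s₁ ≤ TAIL` (lower every other private gate to `0`; the configuration `{s₀, s₁}` alone crosses at every depth `≥ l`;
  `Σ_{i ≥ l} pd i = ∏_{i<l} q i`).
* `Quant.BlockComb.tail_ge_of_carrier_pair` — **the non-mergeable corner with two carriers.**  If `j ≥ 1`, no live blob is a giant (`a ≤ j`), the two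
  designated blobs have marginals `ρ₀, ρ₁ ≤ 1` (and `≥ x` when live), `x ≤ 1`, and `j(1 − x) < a s₀(ρ₀ − x) + a s₁(ρ₁ − x)` — which is what a live tied
  root blob `τ` that p1's merge cannot move (`x·(n − a τ) < j`) forces through the budget — then both are live, `ρ₀ + ρ₁ > 1 + x` (so `ρ₀ρ₁ > x`),
  `a s₀ + a s₁ ≥ j + 1`, and the pair witness at the deeper of the two levels gives `x ≤ TAIL`.
[this work]
-/

namespace Summit.CriticalPhenomena.PercolationContinuityZ3.Theorems

namespace Quant

namespace BlockComb

open Finset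

variable {κ : Type*} [Fintype κ] [DecidableEq κ]

/-- product-Bernoulli weight of the set `S` of open blob gates -/
local notation3 "wt[" g ", " S "]" => ∏ k, (if k ∈ (S : Finset κ) then (g : κ → ℝ) k else 1 - (g : κ → ℝ) k)

/-- probability that the chain `q` of length `D` is open exactly to depth `i` -/
local notation3 "pd[" D ", " q ", " i "]" =>
  (∏ i' ∈ Finset.range (i : ℕ), (q : ℕ → ℝ) i') * (if (i : ℕ) < (D : ℕ) then 1 - (q : ℕ → ℝ) i else 1)

/-- mass counted at depth `i` in blob configuration `S` -/
local notation3 "mass[" lv ", " a ", " i ", " S "]" =>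
  ∑ k ∈ (S : Finset κ).filter (fun k => (lv : κ → ℕ) k ≤ (i : ℕ)), ((a : κ → ℕ) k : ℕ)

/-- the tail `P(N ≥ j+1)` of the block-comb count, as an explicit finite sum -/
local notation3 "TAIL[" D ", " q ", " lv ", " a ", " g ", " j "]" =>
  ∑ i ∈ Finset.range ((D : ℕ) + 1), pd[D, q, i] *
    ∑ S : Finset κ, wt[g, S] * (if (j : ℕ) + 1 ≤ mass[lv, a, i, S] then (1 : ℝ) else 0)

/-- the root-level crossing probability `Φ₀ = Σ_S wt S·𝟙[j+1 ≤ root mass of S]` (the chain closed at its first gate) -/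
local notation3 "ROOT[" lv ", " a ", " g ", " j "]" =>
  ∑ S : Finset κ, wt[g, S] * (if (j : ℕ) + 1 ≤ mass[lv, a, 0, S] then (1 : ℝ) else 0)

/-! ### 1. The pair witness -/

/-- **Pair witness.**  Two distinct blobs `s₀, s₁` of total size `≥ j+1`, both at levels `≤ l ≤ D`: `(∏_{i<l} q i)·g s₀·g s₁ ≤ TAIL`
(the chain open to depth `≥ l` and both private gates open).  Proof: lower every other private gate to `0` (`tail_mono_gates`); then for each
depth `i ≥ l` the configuration `{s₀, s₁}` alone contributes `g s₀·g s₁`, and `Σ_{i ≥ l} pd i = ∏_{i<l} q i` (`pd_tail_sum`). [this work] -/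
theorem tail_ge_pair_witness (D : ℕ) (q : ℕ → ℝ) (hq : ∀ i, 0 ≤ q i ∧ q i ≤ 1) (lv : κ → ℕ) (a : κ → ℕ)
    (g : κ → ℝ) (hg : ∀ k, 0 ≤ g k ∧ g k ≤ 1) (j : ℕ) (s₀ s₁ : κ) (hne : s₀ ≠ s₁)
    (hsize : j + 1 ≤ a s₀ + a s₁) (l : ℕ) (hl₀ : lv s₀ ≤ l) (hl₁ : lv s₁ ≤ l) (hlD : l ≤ D) :
    (∏ i ∈ Finset.range l, q i) * (g s₀ * g s₁) ≤ TAIL[D, q, lv, a, g, j] := by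
  -- lower every other private gate to `0`
  set g' : κ → ℝ := fun k => if k = s₀ ∨ k = s₁ then g k else 0 with hg'def
  have hg' : ∀ k, 0 ≤ g' k ∧ g' k ≤ 1 := by
    intro k
    by_cases h : k = s₀ ∨ k = s₁
    · rw [hg'def]; simp only [h, if_true]; exact hg k
    · rw [hg'def]; simp only [h, if_false]; norm_num
  have hle : ∀ k, g' k ≤ g k := by
    intro k
    by_cases h : k = s₀ ∨ k = s₁
    · rw [hg'def]; simp only [h, if_true]; exact le_rfl
    · rw [hg'def]; simp only [h, if_false]; exact (hg k).1
  refine le_trans ?_ (tail_mono_gates D q hq lv a g g' hg hg' hle j)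
  -- the weight of the configuration `{s₀, s₁}` under the lowered gates
  have hg'₀ : g' s₀ = g s₀ := by rw [hg'def]; simp
  have hg'₁ : g' s₁ = g s₁ := by rw [hg'def]; simp
  have hpair : wt[g', ({s₀, s₁} : Finset κ)] = g s₀ * g s₁ := by
    show (∏ k, (if k ∈ ({s₀, s₁} : Finset κ) then g' k else 1 - g' k)) = g s₀ * g s₁
    rw [← Finset.mul_prod_erase (Finset.univ : Finset κ) _ (Finset.mem_univ s₀),
      ← Finset.mul_prod_erase ((Finset.univ : Finset κ).erase s₀) _
        (Finset.mem_erase.2 ⟨hne.symm, Finset.mem_univ s₁⟩)]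
    have h0 : (if s₀ ∈ ({s₀, s₁} : Finset κ) then g' s₀ else 1 - g' s₀) = g s₀ := by
      rw [if_pos (Finset.mem_insert_self _ _), hg'₀]
    have h1 : (if s₁ ∈ ({s₀, s₁} : Finset κ) then g' s₁ else 1 - g' s₁) = g s₁ := by
      rw [if_pos (Finset.mem_insert_of_mem (Finset.mem_singleton_self _)), hg'₁]
    have hrest : ∏ k ∈ ((Finset.univ : Finset κ).erase s₀).erase s₁,
        (if k ∈ ({s₀, s₁} : Finset κ) then g' k else 1 - g' k) = 1 := by
      refine Finset.prod_eq_one fun k hk => ?_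
      have hk₁ : k ≠ s₁ := Finset.ne_of_mem_erase hk
      have hk₀ : k ≠ s₀ := Finset.ne_of_mem_erase (Finset.mem_of_mem_erase hk)
      have hkm : k ∉ ({s₀, s₁} : Finset κ) := by
        simp only [Finset.mem_insert, Finset.mem_singleton, not_or]; exact ⟨hk₀, hk₁⟩
      have hgk : g' k = 0 := by rw [hg'def]; simp [hk₀, hk₁]
      rw [if_neg hkm, hgk, sub_zero]
    rw [h0, h1, hrest, mul_one]
  -- for depths `i ≥ l` the configuration `{s₀, s₁}` crosses
  have hinner : ∀ i ∈ Finset.range (D + 1),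
      (if l ≤ i then g s₀ * g s₁ else 0) ≤
        ∑ S : Finset κ, wt[g', S] * (if j + 1 ≤ mass[lv, a, i, S] then (1 : ℝ) else 0) := by
    intro i _
    by_cases hi : l ≤ i
    · rw [if_pos hi, ← hpair]
      have hmass : j + 1 ≤ mass[lv, a, i, ({s₀, s₁} : Finset κ)] := by
        have hfilt : ({s₀, s₁} : Finset κ).filter (fun k => lv k ≤ i) = ({s₀, s₁} : Finset κ) := by
          refine Finset.filter_true_of_mem fun k hk => ?_
          simp only [Finset.mem_insert, Finset.mem_singleton] at hk
          rcases hk with rfl | rfl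
          · exact hl₀.trans hi
          · exact hl₁.trans hi
        show j + 1 ≤ ∑ k ∈ ({s₀, s₁} : Finset κ).filter (fun k => lv k ≤ i), a k
        rw [hfilt, Finset.sum_pair hne]
        exact hsize
      calc wt[g', ({s₀, s₁} : Finset κ)]
          = wt[g', ({s₀, s₁} : Finset κ)] * (if j + 1 ≤ mass[lv, a, i, ({s₀, s₁} : Finset κ)] then (1 : ℝ) else 0) := by
            rw [if_pos hmass, mul_one]
        _ ≤ ∑ S : Finset κ, wt[g', S] * (if j + 1 ≤ mass[lv, a, i, S] then (1 : ℝ) else 0) :=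
            Finset.single_le_sum (f := fun S : Finset κ => wt[g', S] *
                (if j + 1 ≤ mass[lv, a, i, S] then (1 : ℝ) else 0))
              (fun S _ => mul_nonneg (wt_nonneg g' hg' S) (by split_ifs <;> norm_num)) (Finset.mem_univ _)
    · rw [if_neg hi]
      exact Finset.sum_nonneg fun S _ => mul_nonneg (wt_nonneg g' hg' S) (by split_ifs <;> norm_num)
  calc (∏ i ∈ Finset.range l, q i) * (g s₀ * g s₁)
      = (∑ i ∈ (Finset.range (D + 1)).filter (fun i => l ≤ i), pd[D, q, i]) * (g s₀ * g s₁) := by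
        rw [pd_tail_sum q D l hlD]
    _ = ∑ i ∈ Finset.range (D + 1), pd[D, q, i] * (if l ≤ i then g s₀ * g s₁ else 0) := by
        rw [Finset.sum_filter, Finset.sum_mul]
        refine Finset.sum_congr rfl fun i _ => ?_
        by_cases hi : l ≤ i
        · rw [if_pos hi, if_pos hi]
        · rw [if_neg hi, if_neg hi, zero_mul, mul_zero]
    _ ≤ TAIL[D, q, lv, a, g', j] :=
        Finset.sum_le_sum fun i hi => mul_le_mul_of_nonneg_left (hinner i hi) (pd_nonneg D q hq i)

/-! ### 2. The non-mergeable corner with two carriers -/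

/-- **Two carriers past the merge threshold.**  `j ≥ 1`; no live giant (`a k ≤ j`); designated blobs `s₀ ≠ s₁` with marginals
`ρ_i = (∏_{i<lv s_i} q)·g s_i`, `≥ x` when live; `0 < x ≤ 1`; and `j(1 − x) < a s₀(ρ₀ − x) + a s₁(ρ₁ − x)`.  Then `x ≤ TAIL`.
Proof: `a_i ≤ j` gives `ρ₀ + ρ₁ > 1 + x`, hence `ρ₀ρ₁ − x > (1 − ρ₀)(1 − ρ₁) ≥ 0`; `ρ_i ≤ 1` gives `a s₀ + a s₁ > j`; both are live; and the pair
witness at the deeper level `l` reads `TAIL ≥ (∏_{i<l} q)·g s₀·g s₁ = ρ_deep·g_other ≥ ρ₀ρ₁ > x`. [this work] -/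
theorem tail_ge_of_carrier_pair (D : ℕ) (q : ℕ → ℝ) (hq : ∀ i, 0 ≤ q i ∧ q i ≤ 1) (lv : κ → ℕ) (a : κ → ℕ)
    (g : κ → ℝ) (hg : ∀ k, 0 ≤ g k ∧ g k ≤ 1) (j : ℕ) (hlv : ∀ k, 0 < a k → lv k ≤ D)
    (s₀ s₁ : κ) (hne : s₀ ≠ s₁) (x : ℝ) (hx0 : 0 < x) (hx1 : x ≤ 1) (hjpos : 0 < j)
    (hsmall : ∀ k, (a k : ℝ) ≤ j)
    (hheavy₀ : 0 < a s₀ → x ≤ (∏ i ∈ Finset.range (lv s₀), q i) * g s₀)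
    (hheavy₁ : 0 < a s₁ → x ≤ (∏ i ∈ Finset.range (lv s₁), q i) * g s₁)
    (hkey : (j : ℝ) * (1 - x) <
      (a s₀ : ℝ) * ((∏ i ∈ Finset.range (lv s₀), q i) * g s₀ - x) +
        (a s₁ : ℝ) * ((∏ i ∈ Finset.range (lv s₁), q i) * g s₁ - x)) :
    x ≤ TAIL[D, q, lv, a, g, j] := by
  set ρ₀ : ℝ := (∏ i ∈ Finset.range (lv s₀), q i) * g s₀ with hρ₀def
  set ρ₁ : ℝ := (∏ i ∈ Finset.range (lv s₁), q i) * g s₁ with hρ₁def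
  have hρ₀1 : ρ₀ ≤ 1 := mul_le_one₀ (prefixProd_mem q hq _).2 (hg s₀).1 (hg s₀).2
  have hρ₁1 : ρ₁ ≤ 1 := mul_le_one₀ (prefixProd_mem q hq _).2 (hg s₁).1 (hg s₁).2
  have hρ₀g : ρ₀ ≤ g s₀ := by
    rw [hρ₀def]; exact mul_le_of_le_one_left (hg s₀).1 (prefixProd_mem q hq _).2
  have hρ₁g : ρ₁ ≤ g s₁ := by
    rw [hρ₁def]; exact mul_le_of_le_one_left (hg s₁).1 (prefixProd_mem q hq _).2
  have hjR : (0 : ℝ) < j := by exact_mod_cast hjpos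
  have hjx : (0 : ℝ) ≤ 1 - x := by linarith
  -- a dead carrier cannot carry: both designated blobs are live
  have hbound : ∀ {c ρ : ℝ}, c ≤ j → 0 ≤ c → ρ ≤ 1 → c * (ρ - x) ≤ (j : ℝ) * (1 - x) := by
    intro c ρ hc hc0 hρ
    have h1 : c * (ρ - x) ≤ c * (1 - x) := mul_le_mul_of_nonneg_left (by linarith) hc0
    have h2 : c * (1 - x) ≤ (j : ℝ) * (1 - x) := mul_le_mul_of_nonneg_right hc hjx
    linarith
  have ha₀pos : 0 < a s₀ := by
    by_contra h
    have h0 : a s₀ = 0 := by omega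
    have h1 := hbound (hsmall s₁) (Nat.cast_nonneg (a s₁)) hρ₁1
    rw [h0] at hkey; push_cast at hkey
    linarith
  have ha₁pos : 0 < a s₁ := by
    by_contra h
    have h0 : a s₁ = 0 := by omega
    have h1 := hbound (hsmall s₀) (Nat.cast_nonneg (a s₀)) hρ₀1
    rw [h0] at hkey; push_cast at hkey
    linarith
  have hxρ₀ : x ≤ ρ₀ := hheavy₀ ha₀pos
  have hxρ₁ : x ≤ ρ₁ := hheavy₁ ha₁pos
  -- `ρ₀ + ρ₁ > 1 + x`
  have hsum : 1 + x < ρ₀ + ρ₁ := by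
    have h0 : (a s₀ : ℝ) * (ρ₀ - x) ≤ j * (ρ₀ - x) := mul_le_mul_of_nonneg_right (hsmall s₀) (by linarith)
    have h1 : (a s₁ : ℝ) * (ρ₁ - x) ≤ j * (ρ₁ - x) := mul_le_mul_of_nonneg_right (hsmall s₁) (by linarith)
    have h2 : (j : ℝ) * (1 - x) < j * ((ρ₀ - x) + (ρ₁ - x)) := by linarith
    have h3 : 1 - x < (ρ₀ - x) + (ρ₁ - x) := lt_of_mul_lt_mul_left h2 hjR.le
    linarith
  have hprod : x < ρ₀ * ρ₁ := by
    nlinarith [mul_nonneg (sub_nonneg.2 hρ₀1) (sub_nonneg.2 hρ₁1)]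
  -- `a s₀ + a s₁ ≥ j + 1`
  have hxlt1 : x < 1 := by linarith
  have hsize : j + 1 ≤ a s₀ + a s₁ := by
    have h0 : (a s₀ : ℝ) * (ρ₀ - x) ≤ (a s₀ : ℝ) * (1 - x) := mul_le_mul_of_nonneg_left (by linarith) (Nat.cast_nonneg _)
    have h1 : (a s₁ : ℝ) * (ρ₁ - x) ≤ (a s₁ : ℝ) * (1 - x) := mul_le_mul_of_nonneg_left (by linarith) (Nat.cast_nonneg _)
    have h2 : (j : ℝ) * (1 - x) < ((a s₀ : ℝ) + a s₁) * (1 - x) := by linarith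
    have h3 : (j : ℝ) < (a s₀ : ℝ) + a s₁ := lt_of_mul_lt_mul_right h2 (by linarith)
    have h4 : (j : ℝ) < ((a s₀ + a s₁ : ℕ) : ℝ) := by push_cast; exact h3
    exact_mod_cast h4
  -- the pair witness at the deeper of the two levels
  rcases le_total (lv s₀) (lv s₁) with h01 | h10
  · have hw := tail_ge_pair_witness D q hq lv a g hg j s₀ s₁ hne hsize (lv s₁) h01 le_rfl (hlv s₁ ha₁pos)
    refine le_trans ?_ hw
    have h1 : (∏ i ∈ Finset.range (lv s₁), q i) * (g s₀ * g s₁) = ρ₁ * g s₀ := by rw [hρ₁def]; ring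
    rw [h1]
    have h2 : ρ₁ * ρ₀ ≤ ρ₁ * g s₀ := mul_le_mul_of_nonneg_left hρ₀g (hx0.le.trans hxρ₁)
    nlinarith
  · have hw := tail_ge_pair_witness D q hq lv a g hg j s₁ s₀ hne.symm (by omega) (lv s₀) h10 le_rfl (hlv s₀ ha₀pos)
    refine le_trans ?_ hw
    have h1 : (∏ i ∈ Finset.range (lv s₀), q i) * (g s₁ * g s₀) = ρ₀ * g s₁ := by rw [hρ₀def]; ring
    rw [h1]
    have h2 : ρ₀ * ρ₁ ≤ ρ₀ * g s₁ := mul_le_mul_of_nonneg_left hρ₁g (hx0.le.trans hxρ₀)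
    nlinarith

end BlockComb

end Quant

end Summit.CriticalPhenomena.PercolationContinuityZ3.Theorems
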